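import Mathlib
import HarnessLib
import Summits.NavierStokesRegularity.NavierStokesRegularity.Theses.HeteroclinicTriggerChain
import Summits.NavierStokesRegularity.NavierStokesRegularity.Theorems.HeteroclinicTriggerChainTriggerChainTableStatic
import Summits.NavierStokesRegularity.NavierStokesRegularity.Theorems.HeteroclinicTriggerChainTriggerChainTableArc

/-!
# `HeteroclinicTriggerChain` — crux `TriggerChainTable` (item stmt-NavierStokesRegularity-22786): CLOSED

The existential design crux K2 of route `HeteroclinicTriggerChain`: some `R ≥ 1` and some pair
`(α₀, σ)` of four-mode tables on Tao's topology carry an UNSEEDED TRIGGER CHAIN — `α₀ ∈ E₂(R)`,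
`α₀ + βσ ∈ E₂(R/β)` for all `β ∈ (0,1]`, purity, `i₁`-parity, a diagonal polarisation at the pure
state with the single unstable entry `d(i₁,0) = e > 0`, an exact entire connection `H` of the
`ε₀ = 1` cascade of `α₀` from the pure state at shell `0` to the pure state at shell `1`
(complete transfer) with two-sided exponential rates, and a seed nonlinearity `quadTerm 1 σ H`
that does not vanish identically at the upper trigger `(i₁, 1)`.

PROOF = the registered two-stub skeleton of the crux (planner ns-idea-4, BC3 birth v3), composed
verbatim: `TriggerChainTable.stub_static` (module `…TriggerChainTableStatic`: the explicit
three-constant table `e = g = 1`, `R = 2`, seed partner table, all finite table algebra) and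
`TriggerChainTable.stub_arc` (module `…TriggerChainTableArc`: the explicit logistic arc
`x = 1/(1+e^{2et})`, `u = √2 e^{et}/(1+e^{2et})`, `y = 1 - x`, rates `κ = e`, `K = 2`).

HONEST FRAMING: this closes the M-sized DESIGN crux of a line on class rung TL-M3 (a fact about
a MODEL lattice table in Tao's class E₂(R)); the line's deciding crux `TriggerChainFrontStep`
(the robust front step, XL) is untouched. Nothing here is a statement about the Navier–Stokes
equations: NS regularity is NOT proved (or refuted) by this file, and no rung is closed by it.
-/

noncomputable section

set_option linter.dupNamespace false

namespace Summit.NavierStokesRegularity.NavierStokesRegularity.Theorems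

/-- **Crux `TriggerChainTable` of route `HeteroclinicTriggerChain` (item
stmt-NavierStokesRegularity-22786) holds**: composition of the registered stubs
`TriggerChainTable.stub_static` (table algebra, with `R = 2`, `i₀ = 0`, `i₁ = 1`, `e = 1`) and
`TriggerChainTable.stub_arc` (the complete-transfer arc with rates `κ = e`, `K = 2`); the support
clauses of the route statement are read off the three-slot support of the arc family, and the seed
clause from `quadTerm 1 σ H (i₁,1) = c₀ · x · u` with `c₀ ≠ 0` and `x(t₀) u(t₀) ≠ 0`. [this file] -/
theorem heteroclinicTriggerChain_triggerChainTable_proof :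
    Summit.NavierStokesRegularity.NavierStokesRegularity.Theses.HeteroclinicTriggerChain.TriggerChainTable := by
  obtain ⟨R, hR, α₀, σ, hT, hTβ, i₀, i₁, e, d, hne, he, hpur, hpar, hlin, hd, hsg, hex, c₀, hc₀, hseed⟩ :=
    TriggerChainTable.stub_static
  obtain ⟨κ, K, hκ, hK, H, hsupp, o1, o2, o3, hlm, hlp, r1, r2, r3, t₀, hnz⟩ :=
    TriggerChainTable.stub_arc i₀ i₁ hne e he
  refine ⟨R, hR, α₀, σ, hT, hTβ, i₀, i₁, e, κ, K, d, H, hne, he, hκ, hK, hpur, hpar, hlin, hd, hsg,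
    hex H hsupp o1 o2 o3, ?_, ?_, ?_, hlm, hlp, r1, r2, r3, ⟨t₀, ?_⟩⟩
  · -- no negative shells
    intro i n t hn
    exact hsupp i n t (by rintro (⟨-, h⟩ | ⟨-, h⟩ | ⟨-, h⟩) <;> omega)
  · -- above shell `0` only the receiver `(i₀, 1)` is charged
    intro i n t hn hi
    refine hsupp i n t ?_
    rintro (⟨h', -⟩ | ⟨-, h⟩ | ⟨h', -⟩)
    · exact hi h'
    · omega
    · exact hi h'
  · -- nothing at shells `≥ 2`
    intro i n t hn
    exact hsupp i n t (by rintro (⟨-, h⟩ | ⟨-, h⟩ | ⟨-, h⟩) <;> omega)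
  · -- the seed does not vanish identically at the upper trigger
    rw [hseed H hsupp t₀]
    exact mul_ne_zero hc₀ hnz

end Summit.NavierStokesRegularity.NavierStokesRegularity.Theorems
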